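import Literature.AlgebraicGeometry.ModuliOfAbelianVarieties.SiegelFamilyQCMDiscriminantForms
import Literature.AlgebraicGeometry.ModuliOfAbelianVarieties.SiegelFamilyHumbertPairOrder
import HarnessLib

/-!
# The class of the discriminant matrix of a pair of singular relations: base change of the pair, Runge's standard
# pair for an arbitrary `S_Δ`, a reduced pair at every point of `H_q ∩ H_{q′}`, and the simple classes `d = 6, 10`
# (Runge 1999, §1 p. 284, §6 p. 298 and Remark 14)

Layer `Literature/AlgebraicGeometry/ModuliOfAbelianVarieties`, namespace
`Literature.AlgebraicGeometry.ModuliOfAbelianVarieties.SiegelModuli`; lane `lit-hodgefound` (Track 2 foundations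
library, Layer A4), seat `lit-hodgefound-skel-4`, row **A4-68**, FILE 2 (of 2): the DICTIONARY between FILE 1
(`SiegelFamilyQCMDiscriminantForms`: `Gl(2, ℤ)`-classes of abstract discriminant matrices, reduced matrices, the table of
`h_QCM(d)`) and the pairs `(q, q′)` of singular relations on the Siegel family of principally polarised abelian
surfaces (rows A4-66/A4-67: `S_Δ = discMatrix q q′`, the order `ℤ[α, β] = humbertPairOrder q q′` with
`d(ℤ[α, β]) = pairDiscr q q′ = det(S_Δ)/4`, the loci `H_q ⊂ 𝔥₂`).

## Source, verbatim (B. Runge, Tohoku Math. J. 51 (1999); held text `paper:doi-10-2748-tmj-1178224764`)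

* §1, p. 284 (p0002): "Changing the basis gives a similar matrix `S_Δ[g] = g S_Δ ᵗg` for some `g ∈ Gl(2, ℤ)`. This
  implies that QCM-orders are parametrized by certain classes of binary quadratic forms."
* §6, end of the proof of THEOREM 10, p. 298 (p0016): "Hence there is a standard basis like `α = […]`, `β = […]` with
  the same discriminant matrix `S_Δ`. This standard basis has `Δ(α) = 4k + l²`, `Δ(β) = t² − 4c`,
  `Δ(α, β) = t(α)t(β) + 2a`, which provides a basis for arbitrary discriminant matrix `S_Δ`."
  OCR caveat (numbers, not adjectives): the two `4 × 4` integer matrices of the standard basis are garbled in the held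
  scan and are NOT transcribed. This file realises the three PRINTED invariants by an explicit pair of
  Birkenhake–Wilhelm relation vectors: `α ↔` Humbert's normal form `(k, l, −1, 0, 0)` (row A4-64 `humbertNormalForm`,
  `Δ = l² + 4k`, `t(α) = l`) and `β ↔ rungeStdVector t a c = (a, t, 0, 1, c)` (`Δ = t² − 4c`, `t(β) = t`,
  `Δ(α, β) = lt + 2a`), `discMatrix_humbertNormalForm_rungeStdVector`.
* §6, REMARK 14, p. 299 (p0017): "`h_QCM(d) = #{S_Δ ; Δᵢ > 0, det S_Δ = 4d, Δ₁, Δ₂ ≡ 0, 1 (4)} mod Gl(2, ℤ)` … A class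
  is simple if it does not represent non-zero squares … Using the action of `Gl(2, ℤ)`, any `S_Δ` is similar to a
  reduced matrix." (the full quotation, the table and its verification are in FILE 1), and §6 p. 296 (p0014): "if the
  discriminant form of an QCM-order `R` represents a non-zero square, all period points correspond to non-simple
  abelian surfaces" (pointwise form: row A4-66 FILE 5 `isSimple_iff_of_mem_inter`).

## What is proved (definitions with bodies `rungeStdVector`, `hmRel`, `hmRel′` + theorems; NO named fact, NO sorry, net debt 0)

* §1 **`discMatrix_comb`**: `S_Δ(xq + yq′, zq + wq′) = g S_Δ(q, q′) ᵗg` for `g = (x y; z w)` — Runge's "changing the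
  basis gives a similar matrix"; for `det g = ±1`: `isGLEquiv_discMatrix_comb`, **`span_pair_comb`** (the lattice
  `ℤq + ℤq′` is unchanged), **`inter_humbertLocus_comb`** (`H_{q̃} ∩ H_{q̃′} = H_q ∩ H_{q′}`), **`humbertPairOrder_comb`**
  (`ℤ[α̃, β̃] = ℤ[α, β]`), `pairDiscr_comb` (`d` unchanged), and conversely **`isGLEquiv_discMatrix_of_span_eq`** (two
  pairs spanning the same lattice have `Gl(2, ℤ)`-equivalent `S_Δ`): the class `[S_Δ]` is an invariant of the LATTICE
  of relations `ℤq + ℤq′` — "QCM-orders are parametrized by certain classes of binary quadratic forms".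
* §2 `isDiscMatrix_discMatrix` (every `S_Δ(q, q′)` satisfies Remark 14's congruences), `discBinForm_discMatrix`
  (`S_Δ[x, y] = Δ(xq + yq′)`), the STANDARD PAIR: def `rungeStdVector`, `humbertInvariant_rungeStdVector` (`t² − 4c`),
  `humbertPolar_humbertNormalForm_rungeStdVector` (`lt + 2a`), **`discMatrix_humbertNormalForm_rungeStdVector`**,
  `isPrimitiveRel_rungeStdVector`, `linearIndependent_humbertNormalForm_rungeStdVector`, and
  **`exists_pair_discMatrix_eq`** ("provides a basis for arbitrary discriminant matrix `S_Δ`": EVERY matrix with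
  Remark 14's congruences is `S_Δ` of a pair of primitive, independent relations, `α` in normal form with `l ∈ {0,1}`,
  `t(β) ∈ {0,1}`), whence **`isDiscMatrix_iff_exists_pair`**.
* §3 on `𝔥₂`, for `Z ∈ H_q ∩ H_{q′}` with `q, q′` `ℚ`-independent: **`exists_reduced_pair`** (a pair `(q̃, q̃′)` spanning
  the same lattice — same locus, same order `ℤ[α, β]` — whose `S_Δ` is Runge-REDUCED and lies in
  `qcmReducedList (d(ℤ[α, β]))`), **`existsUnique_reducedClass`** (the reduced matrix is unique), and
  `qcmClassNumber_pos_of_mem_inter` (`h_QCM(d(ℤ[α,β])) ≥ 1`).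
* §4 the table's geometric content through row A4-66 FILE 5: `isSimpleDisc_discMatrix_iff` (FILE 1's `IsSimpleDisc` is
  FILE 5's "represents no non-zero square"), **`isSimple_iff_isSimpleDisc`** (`ρ(X_Z) = 3`: `X_Z` simple iff the CLASS
  of `S_Δ` is simple), **`isSimple_of_isGLEquiv_five_one_five`** / **`_five_zero_eight`** (`ρ = 3` and
  `[S_Δ] = [(5 1; 1 5)]` or `[(5 0; 0 8)]` ⟹ `X_Z` simple — the `d = 6, 10` entries of `h_QCM,simple`),
  **`not_isSimple_of_pairDiscr_le`** (`d(ℤ[α,β]) ≤ 11` and `[S_Δ]` neither of the two ⟹ `X_Z` NOT simple, any `ρ`),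
  **`isSimple_iff_of_pairDiscr_le`**; §5 the Hashimoto–Murabayashi pair `q = (−1,0,2,0,1)`, `q′ = (0,1,−1,1,−1)`
  (HM Lemma 4.1.1: "`−τ₁ + 2τ₃ + 1 = 0` with `Δ = 8`, `τ₂ − τ₃ + (τ₂² − τ₁τ₃) − 1 = 0` with `Δ = 5`"; rows A4-66/67
  used it for validation): `discMatrix_hmRel = (8 −4; −4 5)`, `pairDiscr_hmRel = 6`, `isGLEquiv_hmRel` (class
  `(5 1; 1 5)`), **`isSimple_of_mem_hmRel`** (every `ρ = 3` point of `H_q ∩ H_{q′}` is simple, with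
  `End_ℚ(X_Z) ≃ ℍ[ℚ, 8, −24]` from row A4-66 FILE 3).
* §6 REALISATION (the converse of row A4-66 FILE 3 `det_discMatrix_pos`): **`exists_mem_inter_std`** (for `l ∈ {0,1}`,
  `4k + l² > 0`, `det S_Δ > 0` the standard pair's loci MEET in `𝔥₂` — an explicit point: `z₂` real and `z₁` a
  non-real root of `kX² + (lz₂ − a)X − (z₂² + tz₂ + c)` when `k ≥ 1`; `z₂ = z₃ = a + i`, `z₁ = (2a + t) + (1 − D)i` when
  `k = 0`), **`exists_pair_and_mem_of_isDiscMatrix`** (EVERY admissible `S` with `Δ₁ > 0`, `det S > 0` is `S_Δ(q, q′)` for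
  primitive independent `q, q′` with `H_q ∩ H_{q′} ≠ ∅`) and **`exists_order_of_isDiscMatrix`** (so `S` is the
  discriminant matrix of an order `ℤ[α, β] ⊆ ρ_r(End X_Z)` with `4 d(ℤ[α,β]) = det S` — every class counted by
  `h_QCM(d)` occurs; that `ℤ[α, β] = End(X_Z)` at a general point is not claimed).

## Scope / deviations

* Runge's `α, β` are Rosati-invariant integer `4 × 4` matrices; as in rows A4-66/67 they are represented by B–W
  relation vectors `q ∈ ℤ⁵` (`α = R₀(q)`), and "changing the basis" of `ℤα + ℤβ` (modulo `ℤ·1`, on which `Δ`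
  vanishes) is the `Gl(2, ℤ)` action on the pair `(q, q′)`.
* Not claimed: Theorem 10 (for PRIMITIVE `S_Δ` the class determines the pair up to `Γ₂ = Sp₄(ℤ)`), Example 13,
  Cor. 12, the QCM-curves; `Sp₄(ℤ)`-invariance of `S_Δ` is row A4-67 FILE 3 (`discMatrix_humbertVectorConj`) and
  is not restated.

## References

* [Runge1999EndomorphismRingsAbelianSurfaces] B. Runge, Tohoku Math. J. 51 (1999) 283–303: §1 p. 284, §6 pp. 296–299
  (proof of Thm. 10, Remark 14).
* [BirkenhakeWilhelm2003] Ch. Birkenhake, H. Wilhelm, Trans. AMS 355 (2003), §4 (relation vectors, `H_Δ`).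
* [HashimotoMurabayashi1995] K. Hashimoto, N. Murabayashi, Tohoku Math. J. 47 (1995) 271–296, §4.1 Lemma 4.1.1 (held
  text `paper:doi-10-2748-tmj-1178225596` = the RIMS Kôkyûroku 843 version, pp. 184–198; p. 193).
-/

noncomputable section

open Matrix Module

namespace Literature.AlgebraicGeometry.ModuliOfAbelianVarieties

namespace SiegelModuli

open Literature.NumberTheory.Automorphic (siegelUpperHalfSpace mem_siegelUpperHalfSpace_iff)
open Literature.NumberTheory.ModularForms.SiegelUpperHalfSpace
open Literature.Geometry.Kaehler Literature.Geometry.Kaehler.ComplexTorus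

/-! ## §1 Base change of the pair: `S_Δ(xq + yq′, zq + wq′) = g S_Δ ᵗg` -/

section Comb

variable (q q' : Fin 5 → ℤ)

/-- `Δ(xq + yq′, zq + wq′) = xzΔ(q) + (xw + yz)Δ(q,q′) + ywΔ(q′)` (bilinearity). [cite: Runge1999EndomorphismRingsAbelianSurfaces, §6 p. 294] -/
theorem humbertPolar_comb (x y z w : ℤ) :
    humbertPolar (x • q + y • q') (z • q + w • q') =
      x * z * humbertInvariant q + (x * w + y * z) * humbertPolar q q' + y * w * humbertInvariant q' := by
  simp only [humbertPolar_add_left, humbertPolar_add_right, humbertPolar_smul_left, humbertPolar_smul_right,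
    humbertPolar_self]
  rw [humbertPolar_comm q' q]; ring

/-- **"Changing the basis gives a similar matrix `S_Δ[g] = g S_Δ ᵗg`"**: for `g = (x y; z w)` the pair
`(xq + yq′, zq + wq′)` has discriminant matrix `g S_Δ(q, q′) ᵗg` (FILE 1 `discBaseChange`).
[cite: Runge1999EndomorphismRingsAbelianSurfaces, §1 p. 284] -/
theorem discMatrix_comb (x y z w : ℤ) :
    discMatrix (x • q + y • q') (z • q + w • q') = discBaseChange !![x, y; z, w] (discMatrix q q') := by
  rw [discMatrix, discMatrix, discBaseChange_fin_two, humbertInvariant_add_smul_smul, humbertInvariant_add_smul_smul,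
    humbertPolar_comb]
  ext i j
  fin_cases i <;> fin_cases j <;> simp <;> ring

variable {q q'}

/-- The transformed pair is `Gl(2, ℤ)`-equivalent (`det g = ±1`). [cite: Runge1999EndomorphismRingsAbelianSurfaces, §1 p. 284] -/
theorem isGLEquiv_discMatrix_comb {x y z w : ℤ} (hdet : IsUnit (x * w - y * z)) :
    IsGLEquiv (discMatrix q q') (discMatrix (x • q + y • q') (z • q + w • q')) :=
  ⟨!![x, y; z, w], by rw [Matrix.det_fin_two_of]; exact hdet, (discMatrix_comb q q' x y z w).symm⟩

/-- Inverting a unimodular base change: `q = ε(w q̃ − y q̃′)`, `q′ = ε(−z q̃ + x q̃′)` with `ε = xw − yz = ±1`.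
[cite: Runge1999EndomorphismRingsAbelianSurfaces, §1 p. 284] -/
theorem comb_inv {x y z w : ℤ} (hdet : IsUnit (x * w - y * z)) :
    ((x * w - y * z) * w) • (x • q + y • q') + (-((x * w - y * z) * y)) • (z • q + w • q') = q ∧
      (-((x * w - y * z) * z)) • (x • q + y • q') + ((x * w - y * z) * x) • (z • q + w • q') = q' := by
  have hsq : (x * w - y * z) ^ 2 = 1 := by rcases Int.isUnit_iff.1 hdet with h | h <;> simp [h]
  constructor
  · ext i
    simp only [Pi.add_apply, Pi.smul_apply, smul_eq_mul]
    have : (x * w - y * z) * w * (x * q i + y * q' i) + -((x * w - y * z) * y) * (z * q i + w * q' i) =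
        (x * w - y * z) ^ 2 * q i := by ring
    rw [this, hsq, one_mul]
  · ext i
    simp only [Pi.add_apply, Pi.smul_apply, smul_eq_mul]
    have : -((x * w - y * z) * z) * (x * q i + y * q' i) + (x * w - y * z) * x * (z * q i + w * q' i) =
        (x * w - y * z) ^ 2 * q' i := by ring
    rw [this, hsq, one_mul]

/-- **The lattice of relations is unchanged: `ℤq̃ + ℤq̃′ = ℤq + ℤq′`** for a unimodular base change.
[cite: Runge1999EndomorphismRingsAbelianSurfaces, §1 p. 284] -/
theorem span_pair_comb {x y z w : ℤ} (hdet : IsUnit (x * w - y * z)) :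
    Submodule.span ℤ ({x • q + y • q', z • q + w • q'} : Set (Fin 5 → ℤ)) = Submodule.span ℤ {q, q'} := by
  apply le_antisymm
  · rw [Submodule.span_le]
    rintro v (rfl | rfl)
    · exact add_mem (Submodule.smul_mem _ _ (Submodule.subset_span (Set.mem_insert _ _)))
        (Submodule.smul_mem _ _ (Submodule.subset_span (Set.mem_insert_of_mem _ rfl)))
    · exact add_mem (Submodule.smul_mem _ _ (Submodule.subset_span (Set.mem_insert _ _)))
        (Submodule.smul_mem _ _ (Submodule.subset_span (Set.mem_insert_of_mem _ rfl)))
  · obtain ⟨hq, hq'⟩ := comb_inv (q := q) (q' := q') hdet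
    have h1 : ((x * w - y * z) * w) • (x • q + y • q') + (-((x * w - y * z) * y)) • (z • q + w • q') ∈
        Submodule.span ℤ ({x • q + y • q', z • q + w • q'} : Set (Fin 5 → ℤ)) :=
      add_mem (Submodule.smul_mem _ _ (Submodule.subset_span (Set.mem_insert _ _)))
        (Submodule.smul_mem _ _ (Submodule.subset_span (Set.mem_insert_of_mem _ rfl)))
    have h2 : (-((x * w - y * z) * z)) • (x • q + y • q') + ((x * w - y * z) * x) • (z • q + w • q') ∈
        Submodule.span ℤ ({x • q + y • q', z • q + w • q'} : Set (Fin 5 → ℤ)) :=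
      add_mem (Submodule.smul_mem _ _ (Submodule.subset_span (Set.mem_insert _ _)))
        (Submodule.smul_mem _ _ (Submodule.subset_span (Set.mem_insert_of_mem _ rfl)))
    rw [hq] at h1
    rw [hq'] at h2
    rw [Submodule.span_le]
    rintro v (rfl | rfl)
    · exact h1
    · exact h2

variable {Z : siegelUpperHalfSpace 2}

/-- **The locus is unchanged: `H_{q̃} ∩ H_{q̃′} = H_q ∩ H_{q′}`** for a unimodular base change of the pair (the locus
depends only on the lattice of relations). [cite: Runge1999EndomorphismRingsAbelianSurfaces, §1 p. 284] [cite: BirkenhakeWilhelm2003, §4 eq. (11) (p. 1830)] -/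
theorem inter_humbertLocus_comb {x y z w : ℤ} (hdet : IsUnit (x * w - y * z)) :
    humbertLocus (fun i ↦ ((x • q + y • q') i : ℂ)) ∩ humbertLocus (fun i ↦ ((z • q + w • q') i : ℂ)) =
      humbertLocus (fun i ↦ (q i : ℂ)) ∩ humbertLocus (fun i ↦ (q' i : ℂ)) := by
  ext W
  constructor
  · rintro ⟨h₀, h₁⟩
    obtain ⟨hq, hq'⟩ := comb_inv (q := q) (q' := q') hdet
    refine ⟨?_, ?_⟩
    · have := mem_humbertLocus_smul_add_smul h₀ h₁ ((x * w - y * z) * w) (-((x * w - y * z) * y))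
      rwa [hq] at this
    · have := mem_humbertLocus_smul_add_smul h₀ h₁ (-((x * w - y * z) * z)) ((x * w - y * z) * x)
      rwa [hq'] at this
  · rintro ⟨h₀, h₁⟩
    exact ⟨mem_humbertLocus_smul_add_smul h₀ h₁ x y, mem_humbertLocus_smul_add_smul h₀ h₁ z w⟩

/-- `R₀` is `ℤ`-linear: `R₀(cq) = c·R₀(q)` (B–W (9) is linear in the relation vector; restated here because row A4-67
FILE 3's copy is not in this file's import cone). [cite: BirkenhakeWilhelm2003, §4 eq. (9) (p. 1827)] -/
private theorem humbertRatRep_zsmul (c : ℤ) (q : Fin 5 → ℤ) : humbertRatRep (c • q) = c • humbertRatRep q := by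
  ext i j
  rcases i with i | i <;> rcases j with j | j <;> fin_cases i <;> fin_cases j <;>
    simp [humbertRatRep, Matrix.smul_apply]

/-- `R₀(xq + yq′) = x R₀(q) + y R₀(q′)`. [cite: BirkenhakeWilhelm2003, §4 eq. (9) (p. 1827)] -/
theorem humbertRatRep_comb (x y : ℤ) (q q' : Fin 5 → ℤ) :
    humbertRatRep (x • q + y • q') = x • humbertRatRep q + y • humbertRatRep q' := by
  rw [humbertRatRep_add, humbertRatRep_zsmul, humbertRatRep_zsmul]

/-- `ℤ[α̃, β̃] ⊆ ℤ[α, β]` for ANY integer base change. [cite: Runge1999EndomorphismRingsAbelianSurfaces, §1 p. 284 and §6 proof of Cor. 9 (p. 296)] -/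
theorem humbertPairOrder_comb_le (x y z w : ℤ) :
    humbertPairOrder (x • q + y • q') (z • q + w • q') ≤ humbertPairOrder q q' := by
  rw [humbertPairOrder_def, Algebra.adjoin_le_iff]
  rintro M (rfl | rfl)
  · rw [SetLike.mem_coe, humbertRatRep_comb]
    exact add_mem (Subalgebra.smul_mem _ (humbertRatRep_mem_humbertPairOrder_left q q') _)
      (Subalgebra.smul_mem _ (humbertRatRep_mem_humbertPairOrder_right q q') _)
  · rw [SetLike.mem_coe, humbertRatRep_comb]
    exact add_mem (Subalgebra.smul_mem _ (humbertRatRep_mem_humbertPairOrder_left q q') _)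
      (Subalgebra.smul_mem _ (humbertRatRep_mem_humbertPairOrder_right q q') _)

/-- **The order is unchanged: `ℤ[α̃, β̃] = ℤ[α, β]`** for a unimodular base change — `d(R) = det(S_Δ)/4` and the
class of `S_Δ` are invariants of the ORDER with its pair of generators up to `Gl(2, ℤ)`.
[cite: Runge1999EndomorphismRingsAbelianSurfaces, §1 p. 284 ("The discriminant of `R` is `d(R) = det(S_Δ)/4`. Changing the basis gives a similar matrix")] -/
theorem humbertPairOrder_comb {x y z w : ℤ} (hdet : IsUnit (x * w - y * z)) :
    humbertPairOrder (x • q + y • q') (z • q + w • q') = humbertPairOrder q q' := by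
  refine le_antisymm (humbertPairOrder_comb_le x y z w) ?_
  obtain ⟨hq, hq'⟩ := comb_inv (q := q) (q' := q') hdet
  have h := humbertPairOrder_comb_le (q := x • q + y • q') (q' := z • q + w • q')
    ((x * w - y * z) * w) (-((x * w - y * z) * y)) (-((x * w - y * z) * z)) ((x * w - y * z) * x)
  rwa [hq, hq'] at h

/-- Integer relations between `ℚ`-independent vectors vanish: `aq + bq′ = 0 ⟹ a = b = 0`.
[cite: Runge1999EndomorphismRingsAbelianSurfaces, §6 Thm. 7 (p. 294: "`R ⊗ ℚ = ℚ ⊕ ℚα ⊕ ℚβ ⊕ ℚαβ`")] -/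
theorem eq_zero_of_smul_add_smul_eq_zero_of_linearIndependent
    (hli : LinearIndependent ℚ ![(fun i ↦ (q i : ℚ)), (fun i ↦ (q' i : ℚ))]) {a b : ℤ} (h : a • q + b • q' = 0) :
    a = 0 ∧ b = 0 := by
  have h' : (a : ℚ) • (fun i ↦ (q i : ℚ)) + (b : ℚ) • (fun i ↦ (q' i : ℚ)) = 0 := by
    funext i
    have := congrFun h i
    simp only [Pi.add_apply, Pi.smul_apply, smul_eq_mul, Pi.zero_apply] at this ⊢
    exact_mod_cast this
  obtain ⟨ha, hb⟩ := LinearIndependent.pair_iff.1 hli _ _ h'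
  exact ⟨by exact_mod_cast ha, by exact_mod_cast hb⟩

/-- **The class `[S_Δ]` depends only on the LATTICE `ℤq + ℤq′`**: two pairs of relations spanning the same lattice
(`q, q′` independent) differ by a unimodular base change, so their discriminant matrices are `Gl(2, ℤ)`-equivalent
("QCM-orders are parametrized by certain classes of binary quadratic forms"). [cite: Runge1999EndomorphismRingsAbelianSurfaces, §1 p. 284] -/
theorem isGLEquiv_discMatrix_of_span_eq (hli : LinearIndependent ℚ ![(fun i ↦ (q i : ℚ)), (fun i ↦ (q' i : ℚ))])
    {p p' : Fin 5 → ℤ} (h : Submodule.span ℤ ({p, p'} : Set (Fin 5 → ℤ)) = Submodule.span ℤ {q, q'}) :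
    IsGLEquiv (discMatrix q q') (discMatrix p p') := by
  have hp : p ∈ Submodule.span ℤ ({q, q'} : Set (Fin 5 → ℤ)) := h ▸ Submodule.subset_span (Set.mem_insert _ _)
  have hp' : p' ∈ Submodule.span ℤ ({q, q'} : Set (Fin 5 → ℤ)) :=
    h ▸ Submodule.subset_span (Set.mem_insert_of_mem _ rfl)
  rw [Submodule.mem_span_pair] at hp hp'
  obtain ⟨x, y, rfl⟩ := hp
  obtain ⟨z, w, rfl⟩ := hp'
  have hq : q ∈ Submodule.span ℤ ({x • q + y • q', z • q + w • q'} : Set (Fin 5 → ℤ)) :=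
    h.symm ▸ Submodule.subset_span (Set.mem_insert _ _)
  have hq' : q' ∈ Submodule.span ℤ ({x • q + y • q', z • q + w • q'} : Set (Fin 5 → ℤ)) :=
    h.symm ▸ Submodule.subset_span (Set.mem_insert_of_mem _ rfl)
  rw [Submodule.mem_span_pair] at hq hq'
  obtain ⟨a, b, hab⟩ := hq
  obtain ⟨c, d, hcd⟩ := hq'
  have e1 : (a * x + b * z - 1) • q + (a * y + b * w) • q' = 0 := by
    have : (a * x + b * z - 1) • q + (a * y + b * w) • q' = a • (x • q + y • q') + b • (z • q + w • q') - q := by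
      ext i; simp only [Pi.add_apply, Pi.sub_apply, Pi.smul_apply, smul_eq_mul]; ring
    rw [this, hab, sub_self]
  have e2 : (c * x + d * z) • q + (c * y + d * w - 1) • q' = 0 := by
    have : (c * x + d * z) • q + (c * y + d * w - 1) • q' = c • (x • q + y • q') + d • (z • q + w • q') - q' := by
      ext i; simp only [Pi.add_apply, Pi.sub_apply, Pi.smul_apply, smul_eq_mul]; ring
    rw [this, hcd, sub_self]
  obtain ⟨h11, h12⟩ := eq_zero_of_smul_add_smul_eq_zero_of_linearIndependent hli e1
  obtain ⟨h21, h22⟩ := eq_zero_of_smul_add_smul_eq_zero_of_linearIndependent hli e2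
  have hunit : IsUnit (x * w - y * z) :=
    isUnit_of_dvd_one ⟨a * d - b * c, by linear_combination -(c * y + d * w) * h11 + (c * x + d * z) * h12 - h22⟩
  exact isGLEquiv_discMatrix_comb hunit

/-- **`d(ℤ[α, β]) = det(S_Δ)/4` is unchanged** by a unimodular base change. [cite: Runge1999EndomorphismRingsAbelianSurfaces, §1 p. 284] -/
theorem pairDiscr_comb {x y z w : ℤ} (hdet : IsUnit (x * w - y * z)) :
    pairDiscr (x • q + y • q') (z • q + w • q') = pairDiscr q q' := by
  have h := (isGLEquiv_discMatrix_comb (q := q) (q' := q') hdet).det_eq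
  have h1 := four_mul_pairDiscr (x • q + y • q') (z • q + w • q')
  have h2 := four_mul_pairDiscr q q'
  linarith

end Comb

/-! ## §2 Every `S_Δ(q, q′)` is admissible; Runge's standard pair realises every admissible matrix -/

section StandardPair

/-- **`S_Δ(q, q′)` satisfies Remark 14's congruences**: symmetric, `Δ(q), Δ(q′) ≡ 0, 1 (4)` (B–W: "the invariant `Δ` is
always `≡ 0` or `1 mod 4`"), `4 ∣ det S_Δ` (row A4-67: `det S_Δ = 4 d(ℤ[α,β])`). [cite: Runge1999EndomorphismRingsAbelianSurfaces, Remark 14 (p. 299)] -/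
theorem isDiscMatrix_discMatrix (q q' : Fin 5 → ℤ) : IsDiscMatrix (discMatrix q q') where
  symm := by simp [discMatrix]
  fst_emod_four := by simpa [discMatrix] using humbertInvariant_emod_four q
  snd_emod_four := by simpa [discMatrix] using humbertInvariant_emod_four q'
  four_dvd_det := by rw [det_discMatrix]; exact four_dvd_det_discMatrix' q q'

/-- **`S_Δ[x, y] = Δ(xq + yq′)`**: FILE 1's binary form of `S_Δ(q, q′)` is Humbert's invariant of the combined relation.
[cite: Runge1999EndomorphismRingsAbelianSurfaces, §6 p. 294 and Remark 14 (p. 299)] -/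
theorem discBinForm_discMatrix (q q' : Fin 5 → ℤ) (x y : ℤ) :
    discBinForm (discMatrix q q') x y = humbertInvariant (x • q + y • q') := by
  rw [discBinForm, humbertInvariant_add_smul_smul]; simp [discMatrix]; ring

/-- The same, in the expanded shape used by row A4-66 FILE 5. [cite: Runge1999EndomorphismRingsAbelianSurfaces, Remark 14 (p. 299)] -/
theorem discBinForm_discMatrix' (q q' : Fin 5 → ℤ) (x y : ℤ) :
    discBinForm (discMatrix q q') x y =
      x ^ 2 * humbertInvariant q + 2 * x * y * humbertPolar q q' + y ^ 2 * humbertInvariant q' := by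
  rw [discBinForm_discMatrix, humbertInvariant_add_smul_smul]

variable (t a c : ℤ)

/-- **Runge's second standard vector `β ↔ (a, t, 0, 1, c)`** — the singular relation `a z₁ + t z₂ + (z₂² − z₁z₃) + c = 0`,
chosen so that against Humbert's normal form `α ↔ (k, l, −1, 0, 0)` the three printed invariants come out:
`Δ(β) = t² − 4c`, `Δ(α, β) = t(α)t(β) + 2a = lt + 2a` (the printed `4 × 4` matrix of `β` is OCR-garbled in the held
text and is not transcribed; see the module docstring). [cite: Runge1999EndomorphismRingsAbelianSurfaces, §6 proof of Thm. 10 (p. 298)] -/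
def rungeStdVector : Fin 5 → ℤ := ![a, t, 0, 1, c]

/-- Unfolding of `rungeStdVector`. [cite: Runge1999EndomorphismRingsAbelianSurfaces, §6 proof of Thm. 10 (p. 298)] -/
theorem rungeStdVector_apply : rungeStdVector t a c = ![a, t, 0, 1, c] := rfl

/-- **`Δ(β) = t² − 4c`.** [cite: Runge1999EndomorphismRingsAbelianSurfaces, §6 proof of Thm. 10 (p. 298: "`Δ(β) = t² − 4c`")] -/
theorem humbertInvariant_rungeStdVector : humbertInvariant (rungeStdVector t a c) = t ^ 2 - 4 * c := by
  simp [humbertInvariant, rungeStdVector]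

/-- `t(β) = t`: the `b`-coordinate (reduced trace of `R₀`, row A4-67 FILE 1 `rungeTrace_map_humbertRatRep`) is `t`.
[cite: Runge1999EndomorphismRingsAbelianSurfaces, §6 proof of Thm. 10 (p. 298)] -/
theorem rungeStdVector_one : rungeStdVector t a c 1 = t := by simp [rungeStdVector]

variable (k l : ℤ)

/-- **`Δ(α, β) = t(α)t(β) + 2a = lt + 2a`** for `α ↔ (k, l, −1, 0, 0)`, `β ↔ (a, t, 0, 1, c)`.
[cite: Runge1999EndomorphismRingsAbelianSurfaces, §6 proof of Thm. 10 (p. 298: "`Δ(α, β) = t(α)t(β) + 2a`")] -/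
theorem humbertPolar_humbertNormalForm_rungeStdVector :
    humbertPolar (humbertNormalForm k l) (rungeStdVector t a c) = l * t + 2 * a := by
  simp only [humbertPolar, humbertNormalForm, rungeStdVector, Matrix.cons_val_zero, Matrix.cons_val_one,
    Matrix.cons_val]
  ring

/-- **The discriminant matrix of the standard pair: `S_Δ = (4k + l², lt + 2a; lt + 2a, t² − 4c)`.**
[cite: Runge1999EndomorphismRingsAbelianSurfaces, §6 proof of Thm. 10 (p. 298: "This standard basis has `Δ(α) = 4k + l²`, `Δ(β) = t² − 4c`, `Δ(α, β) = t(α)t(β) + 2a`")] -/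
theorem discMatrix_humbertNormalForm_rungeStdVector :
    discMatrix (humbertNormalForm k l) (rungeStdVector t a c) =
      !![4 * k + l ^ 2, l * t + 2 * a; l * t + 2 * a, t ^ 2 - 4 * c] := by
  rw [discMatrix, humbertPolar_humbertNormalForm_rungeStdVector, humbertInvariant_rungeStdVector,
    humbertInvariant_humbertNormalForm, quadDisc, add_comm (l ^ 2) (4 * k)]

/-- The standard vector is PRIMITIVE (its `d`-coordinate is `1`). [cite: Runge1999EndomorphismRingsAbelianSurfaces, §6 proof of Thm. 10 (p. 298)] -/
theorem isPrimitiveRel_rungeStdVector : IsPrimitiveRel (rungeStdVector t a c) := by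
  intro m p h
  have h3 : (m • p) 3 = 1 := by rw [← h]; simp [rungeStdVector]
  rw [Pi.smul_apply, smul_eq_mul] at h3
  exact Int.isUnit_iff.1 (isUnit_of_dvd_one ⟨p 3, h3.symm⟩)

/-- The standard pair is `ℚ`-linearly independent (look at the `c`- and `d`-coordinates).
[cite: Runge1999EndomorphismRingsAbelianSurfaces, §6 proof of Thm. 10 (p. 298)] -/
theorem linearIndependent_humbertNormalForm_rungeStdVector :
    LinearIndependent ℚ ![(fun i ↦ (humbertNormalForm k l i : ℚ)), (fun i ↦ (rungeStdVector t a c i : ℚ))] := by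
  rw [LinearIndependent.pair_iff]
  intro s s' h
  have h2 := congrFun h 2
  have h3 := congrFun h 3
  simp [humbertNormalForm, rungeStdVector] at h2 h3
  exact ⟨h2, h3⟩

/-- **"… which provides a basis for arbitrary discriminant matrix `S_Δ`": every matrix with Remark 14's congruences
is the discriminant matrix of a standard pair** `((k, l, −1, 0, 0), (a, t, 0, 1, c))` with `l, t ∈ {0, 1}`
(`l ≡ Δ₁`, `t ≡ Δ₂ (mod 4)`, `k = (Δ₁ − l)/4`, `c = (t − Δ₂)/4`, `a = (Δ − lt)/2` — an integer by the parity lemma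
`IsDiscMatrix.two_dvd_iff`). [cite: Runge1999EndomorphismRingsAbelianSurfaces, §6 proof of Thm. 10 (p. 298)] -/
theorem exists_pair_discMatrix_eq {S : Matrix (Fin 2) (Fin 2) ℤ} (hS : IsDiscMatrix S) :
    ∃ k l t a c : ℤ, (l = 0 ∨ l = 1) ∧ (t = 0 ∨ t = 1) ∧
      discMatrix (humbertNormalForm k l) (rungeStdVector t a c) = S := by
  have ha := hS.fst_emod_four
  have hc := hS.snd_emod_four
  have hpar := hS.two_dvd_iff
  refine ⟨(S 0 0 - S 0 0 % 4) / 4, S 0 0 % 4, S 1 1 % 4, (S 0 1 - (S 0 0 % 4) * (S 1 1 % 4)) / 2,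
    (S 1 1 % 4 - S 1 1) / 4, by omega, by omega, ?_⟩
  have e1 : 4 * ((S 0 0 - S 0 0 % 4) / 4) + (S 0 0 % 4) ^ 2 = S 0 0 := by
    rcases ha with h | h <;> rw [h] <;> omega
  have e3 : (S 1 1 % 4) ^ 2 - 4 * ((S 1 1 % 4 - S 1 1) / 4) = S 1 1 := by
    rcases hc with h | h <;> rw [h] <;> omega
  have e2 : S 0 0 % 4 * (S 1 1 % 4) + 2 * ((S 0 1 - S 0 0 % 4 * (S 1 1 % 4)) / 2) = S 0 1 := by
    by_cases h11 : S 0 0 % 4 = 1 ∧ S 1 1 % 4 = 1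
    · have hodd : ¬ (2 : ℤ) ∣ S 0 1 := fun h2 ↦ hpar.1 h2 h11
      rw [h11.1, h11.2]; omega
    · obtain ⟨m, hm⟩ := hpar.2 h11
      have h0 : S 0 0 % 4 * (S 1 1 % 4) = 0 := by
        rcases ha with h | h <;> rcases hc with h' | h' <;> simp_all
      rw [h0, hm]; omega
  rw [discMatrix_humbertNormalForm_rungeStdVector, e1, e2, e3]
  exact symMat_entries hS.symm

/-- **Remark 14's set is exactly the set of discriminant matrices of pairs of singular relations.**
[cite: Runge1999EndomorphismRingsAbelianSurfaces, Remark 14 (p. 299) and §6 proof of Thm. 10 (p. 298)] -/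
theorem isDiscMatrix_iff_exists_pair (S : Matrix (Fin 2) (Fin 2) ℤ) :
    IsDiscMatrix S ↔ ∃ q q' : Fin 5 → ℤ, discMatrix q q' = S := by
  constructor
  · intro hS
    obtain ⟨k, l, t, a, c, -, -, h⟩ := exists_pair_discMatrix_eq hS
    exact ⟨_, _, h⟩
  · rintro ⟨q, q', rfl⟩; exact isDiscMatrix_discMatrix q q'

/-- Sharper: every admissible matrix is `S_Δ` of a pair of PRIMITIVE, `ℚ`-INDEPENDENT relations (so rows A4-65/66's
hypotheses are met by the standard pair). [cite: Runge1999EndomorphismRingsAbelianSurfaces, §6 proof of Thm. 10 (p. 298)] -/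
theorem exists_primitive_pair_discMatrix_eq {S : Matrix (Fin 2) (Fin 2) ℤ} (hS : IsDiscMatrix S) :
    ∃ q q' : Fin 5 → ℤ, IsPrimitiveRel q ∧ IsPrimitiveRel q' ∧
      LinearIndependent ℚ ![(fun i ↦ (q i : ℚ)), (fun i ↦ (q' i : ℚ))] ∧ discMatrix q q' = S := by
  obtain ⟨k, l, t, a, c, -, -, h⟩ := exists_pair_discMatrix_eq hS
  exact ⟨_, _, isPrimitiveRel_humbertNormalForm k l, isPrimitiveRel_rungeStdVector t a c,
    linearIndependent_humbertNormalForm_rungeStdVector t a c k l, h⟩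

end StandardPair

/-! ## §3 On `𝔥₂`: a reduced pair at every point of `H_q ∩ H_{q′}` -/

section OnSiegel

variable {q q' : Fin 5 → ℤ} {Z : siegelUpperHalfSpace 2}

/-- `d(ℤ[α, β])` as a natural number equals `pairDiscr` on the intersection (it is positive there, row A4-67 FILE 2).
[cite: Runge1999EndomorphismRingsAbelianSurfaces, §6 Thm. 7 (p. 295)] -/
theorem toNat_pairDiscr (h₀ : Z ∈ humbertLocus (fun i ↦ (q i : ℂ))) (h₁ : Z ∈ humbertLocus (fun i ↦ (q' i : ℂ)))
    (hli : LinearIndependent ℚ ![(fun i ↦ (q i : ℚ)), (fun i ↦ (q' i : ℚ))]) :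
    ((pairDiscr q q').toNat : ℤ) = pairDiscr q q' :=
  Int.toNat_of_nonneg (pairDiscr_pos h₀ h₁ hli).le

/-- `det S_Δ(q, q′) = 4 d` with `d = d(ℤ[α,β]).toNat` on the intersection. [cite: Runge1999EndomorphismRingsAbelianSurfaces, §6 Thm. 7 (p. 295: "`d(R) = det(S_Δ)/4`")] -/
theorem det_discMatrix_eq_four_mul (h₀ : Z ∈ humbertLocus (fun i ↦ (q i : ℂ)))
    (h₁ : Z ∈ humbertLocus (fun i ↦ (q' i : ℂ))) (hli : LinearIndependent ℚ ![(fun i ↦ (q i : ℚ)), (fun i ↦ (q' i : ℚ))]) :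
    (discMatrix q q').det = 4 * ((pairDiscr q q').toNat : ℕ) := by
  rw [toNat_pairDiscr h₀ h₁ hli, four_mul_pairDiscr]

/-- **A REDUCED PAIR at every point of `H_q ∩ H_{q′}`** (`q, q′` independent): there is a unimodular base change
`(q̃, q̃′) = (xq + yq′, zq + wq′)` — same lattice, same locus `H_{q̃} ∩ H_{q̃′} = H_q ∩ H_{q′}`, same order
`ℤ[α̃, β̃] = ℤ[α, β]` — whose discriminant matrix is Runge-REDUCED and is one of the finitely many matrices of
`qcmReducedList d`, `d = d(ℤ[α, β])` ("any `S_Δ` is similar to a reduced matrix").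
[cite: Runge1999EndomorphismRingsAbelianSurfaces, Remark 14 (p. 299) and §1 p. 284] -/
theorem exists_reduced_pair (h₀ : Z ∈ humbertLocus (fun i ↦ (q i : ℂ))) (h₁ : Z ∈ humbertLocus (fun i ↦ (q' i : ℂ)))
    (hli : LinearIndependent ℚ ![(fun i ↦ (q i : ℚ)), (fun i ↦ (q' i : ℚ))]) :
    ∃ x y z w : ℤ, IsUnit (x * w - y * z) ∧
      Z ∈ humbertLocus (fun i ↦ ((x • q + y • q') i : ℂ)) ∧ Z ∈ humbertLocus (fun i ↦ ((z • q + w • q') i : ℂ)) ∧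
      Submodule.span ℤ ({x • q + y • q', z • q + w • q'} : Set (Fin 5 → ℤ)) = Submodule.span ℤ {q, q'} ∧
      humbertPairOrder (x • q + y • q') (z • q + w • q') = humbertPairOrder q q' ∧
      IsRungeReduced (discMatrix (x • q + y • q') (z • q + w • q')) ∧
      (humbertInvariant (x • q + y • q'), humbertPolar (x • q + y • q') (z • q + w • q'),
        humbertInvariant (z • q + w • q')) ∈ qcmReducedList (pairDiscr q q').toNat := by
  have hD := isDiscMatrix_discMatrix q q'
  have ha : 0 < discMatrix q q' 0 0 := by simpa [discMatrix] using humbertInvariant_pos_left h₀ h₁ hli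
  have hdet : 0 < (discMatrix q q').det := det_discMatrix_pos' h₀ h₁ hli
  obtain ⟨S', ⟨g, hg, hgS⟩, hsymm, ha', hred⟩ := exists_isGLEquiv_isRungeReduced hD.symm ha hdet
  have hgd : g.det = g 0 0 * g 1 1 - g 0 1 * g 1 0 := Matrix.det_fin_two g
  have hunit : IsUnit (g 0 0 * g 1 1 - g 0 1 * g 1 0) := by rw [← hgd]; exact hg
  have hcomb : discMatrix (g 0 0 • q + g 0 1 • q') (g 1 0 • q + g 1 1 • q') = S' := by
    rw [discMatrix_comb, ← Matrix.eta_fin_two g, hgS]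
  refine ⟨g 0 0, g 0 1, g 1 0, g 1 1, hunit, mem_humbertLocus_smul_add_smul h₀ h₁ _ _,
    mem_humbertLocus_smul_add_smul h₀ h₁ _ _, span_pair_comb hunit, humbertPairOrder_comb hunit,
    by rw [hcomb]; exact hred, ?_⟩
  have hentries : (humbertInvariant (g 0 0 • q + g 0 1 • q'), humbertPolar (g 0 0 • q + g 0 1 • q') (g 1 0 • q + g 1 1 • q'),
      humbertInvariant (g 1 0 • q + g 1 1 • q')) = (S' 0 0, S' 0 1, S' 1 1) := by
    simp only [← hcomb, discMatrix, Matrix.of_apply, Matrix.cons_val', Matrix.cons_val_zero, Matrix.cons_val_one,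
      Matrix.empty_val', Matrix.cons_val_fin_one]
  rw [hentries, mem_qcmReducedList_iff, isQCMReduced_iff, symMat_entries hsymm]
  have hequiv : IsGLEquiv (discMatrix q q') S' := ⟨g, hg, hgS⟩
  refine ⟨hred, hequiv.isDiscMatrix hD, ha', ?_⟩
  rw [hequiv.det_eq, det_discMatrix_eq_four_mul h₀ h₁ hli]

/-- **The reduced matrix is UNIQUE**: at a point of `H_q ∩ H_{q′}` the class of `S_Δ(q, q′)` contains exactly one matrix of
`qcmReducedList d(ℤ[α,β])` (FILE 1 `existsUnique_isGLEquiv_of_isDiscMatrix`). [cite: Runge1999EndomorphismRingsAbelianSurfaces, Remark 14 (p. 299)] -/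
theorem existsUnique_reducedClass (h₀ : Z ∈ humbertLocus (fun i ↦ (q i : ℂ)))
    (h₁ : Z ∈ humbertLocus (fun i ↦ (q' i : ℂ))) (hli : LinearIndependent ℚ ![(fun i ↦ (q i : ℚ)), (fun i ↦ (q' i : ℚ))]) :
    ∃! t, t ∈ qcmReducedList (pairDiscr q q').toNat ∧ IsGLEquiv (discMatrix q q') (symMat t) :=
  existsUnique_isGLEquiv_of_isDiscMatrix (isDiscMatrix_discMatrix q q')
    (by simpa [discMatrix] using humbertInvariant_pos_left h₀ h₁ hli) (det_discMatrix_eq_four_mul h₀ h₁ hli)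
    (by have := pairDiscr_pos h₀ h₁ hli; omega)

/-- Hence `h_QCM(d(ℤ[α, β])) ≥ 1` at every such point. [cite: Runge1999EndomorphismRingsAbelianSurfaces, Remark 14 (p. 299)] -/
theorem qcmClassNumber_pos_of_mem_inter (h₀ : Z ∈ humbertLocus (fun i ↦ (q i : ℂ)))
    (h₁ : Z ∈ humbertLocus (fun i ↦ (q' i : ℂ))) (hli : LinearIndependent ℚ ![(fun i ↦ (q i : ℚ)), (fun i ↦ (q' i : ℚ))]) :
    0 < qcmClassNumber (pairDiscr q q').toNat := by
  obtain ⟨t, ⟨ht, -⟩, -⟩ := existsUnique_reducedClass h₀ h₁ hli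
  exact List.length_pos_of_mem ht

end OnSiegel

/-! ## §4 The simple classes: `ρ(X_Z) = 3` and `[S_Δ] ∈ {[(5 1; 1 5)], [(5 0; 0 8)]}` ⟹ `X_Z` simple -/

section SimpleClasses

variable {q q' : Fin 5 → ℤ} {Z : siegelUpperHalfSpace 2}

/-- FILE 1's `IsSimpleDisc (S_Δ(q, q′))` is row A4-66 FILE 5's "`S_Δ` represents no non-zero square" (same shape).
[cite: Runge1999EndomorphismRingsAbelianSurfaces, Remark 14 (p. 299) and §6 p. 296] -/
theorem isSimpleDisc_discMatrix_iff (q q' : Fin 5 → ℤ) :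
    IsSimpleDisc (discMatrix q q') ↔
      ∀ x y δ : ℤ, δ ≠ 0 → x ^ 2 * humbertInvariant q + 2 * x * y * humbertPolar q q' + y ^ 2 * humbertInvariant q' ≠ δ ^ 2 := by
  simp only [IsSimpleDisc, discBinForm_discMatrix']

/-- **On `H_q ∩ H_{q′}` with `ρ(X_Z) = 3`: `X_Z` is simple iff the CLASS of `S_Δ(q, q′)` is simple** (row A4-66 FILE 5
`isSimple_iff_forall_discForm_ne_sq`, in FILE 1's vocabulary; the right-hand side is a class invariant,
`IsGLEquiv.isSimpleDisc_iff`). [cite: Runge1999EndomorphismRingsAbelianSurfaces, §6 p. 296 and Remark 14 (p. 299)] -/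
theorem isSimple_iff_isSimpleDisc (h₀ : Z ∈ humbertLocus (fun i ↦ (q i : ℂ)))
    (h₁ : Z ∈ humbertLocus (fun i ↦ (q' i : ℂ))) (hli : LinearIndependent ℚ ![(fun i ↦ (q i : ℚ)), (fun i ↦ (q' i : ℚ))])
    (h3 : finrank ℤ (neronSeveriGroup (prinPeriod Z : (Fin 2 ⊕ Fin 2 → ℝ) ≃L[ℝ] (Fin 2 → ℂ))) = 3) :
    IsSimple (prinPeriod Z : (Fin 2 ⊕ Fin 2 → ℝ) ≃L[ℝ] (Fin 2 → ℂ)) ↔ IsSimpleDisc (discMatrix q q') := by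
  rw [isSimple_iff_forall_discForm_ne_sq h₀ h₁ hli h3, isSimpleDisc_discMatrix_iff]

/-- **The `d = 6` entry of `h_QCM,simple`: `ρ(X_Z) = 3` and `S_Δ(q, q′) ~ (5 1; 1 5)` ⟹ `X_Z` is SIMPLE** — its
endomorphism algebra is then the quaternion DIVISION algebra `ℚ(α, β)` (row A4-66 FILE 3
`nonempty_quaternionAlgebra_algEquiv_endAlgRat_of_isSimple`; `(5, −24)_ℚ` has discriminant `6`, Hashimoto–Murabayashi).
[cite: Runge1999EndomorphismRingsAbelianSurfaces, Remark 14 (p. 299: `h_QCM,simple(6) = 1`)] -/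
theorem isSimple_of_isGLEquiv_five_one_five (h₀ : Z ∈ humbertLocus (fun i ↦ (q i : ℂ)))
    (h₁ : Z ∈ humbertLocus (fun i ↦ (q' i : ℂ))) (hli : LinearIndependent ℚ ![(fun i ↦ (q i : ℚ)), (fun i ↦ (q' i : ℚ))])
    (h3 : finrank ℤ (neronSeveriGroup (prinPeriod Z : (Fin 2 ⊕ Fin 2 → ℝ) ≃L[ℝ] (Fin 2 → ℂ))) = 3)
    (hS : IsGLEquiv (discMatrix q q') !![5, 1; 1, 5]) :
    IsSimple (prinPeriod Z : (Fin 2 ⊕ Fin 2 → ℝ) ≃L[ℝ] (Fin 2 → ℂ)) :=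
  (isSimple_iff_isSimpleDisc h₀ h₁ hli h3).2
    ((hS.isSimpleDisc_iff (isDiscMatrix_discMatrix q q').symm).1 isSimpleDisc_five_one_five)

/-- **The `d = 10` entry of `h_QCM,simple`: `ρ(X_Z) = 3` and `S_Δ(q, q′) ~ (5 0; 0 8)` ⟹ `X_Z` is SIMPLE**
(`(5, −40)_ℚ` has discriminant `10`, Hashimoto–Murabayashi's second example).
[cite: Runge1999EndomorphismRingsAbelianSurfaces, Remark 14 (p. 299: `h_QCM,simple(10) = 1`)] -/
theorem isSimple_of_isGLEquiv_five_zero_eight (h₀ : Z ∈ humbertLocus (fun i ↦ (q i : ℂ)))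
    (h₁ : Z ∈ humbertLocus (fun i ↦ (q' i : ℂ))) (hli : LinearIndependent ℚ ![(fun i ↦ (q i : ℚ)), (fun i ↦ (q' i : ℚ))])
    (h3 : finrank ℤ (neronSeveriGroup (prinPeriod Z : (Fin 2 ⊕ Fin 2 → ℝ) ≃L[ℝ] (Fin 2 → ℂ))) = 3)
    (hS : IsGLEquiv (discMatrix q q') !![5, 0; 0, 8]) :
    IsSimple (prinPeriod Z : (Fin 2 ⊕ Fin 2 → ℝ) ≃L[ℝ] (Fin 2 → ℂ)) :=
  (isSimple_iff_isSimpleDisc h₀ h₁ hli h3).2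
    ((hS.isSimpleDisc_iff (isDiscMatrix_discMatrix q q').symm).1 isSimpleDisc_five_zero_eight)

/-- A represented non-zero square at class level gives a non-simple point (row A4-66 FILE 5
`not_isSimple_of_discForm_eq_sq`; any `ρ`). [cite: Runge1999EndomorphismRingsAbelianSurfaces, §6 p. 296] -/
theorem not_isSimple_of_not_isSimpleDisc (h₀ : Z ∈ humbertLocus (fun i ↦ (q i : ℂ)))
    (h₁ : Z ∈ humbertLocus (fun i ↦ (q' i : ℂ))) (h : ¬ IsSimpleDisc (discMatrix q q')) :
    ¬ IsSimple (prinPeriod Z : (Fin 2 ⊕ Fin 2 → ℝ) ≃L[ℝ] (Fin 2 → ℂ)) := by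
  simp only [IsSimpleDisc, not_forall, not_not, exists_prop] at h
  obtain ⟨x, y, m, hm, hsq⟩ := h
  rw [discBinForm_discMatrix'] at hsq
  exact not_isSimple_of_discForm_eq_sq h₀ h₁ hm hsq

/-- **The zeros of `h_QCM,simple` for `d ≤ 11`: if `d(ℤ[α, β]) ≤ 11` and the class of `S_Δ(q, q′)` is neither
`[(5 1; 1 5)]` nor `[(5 0; 0 8)]`, then `X_Z` is NOT simple at ANY point of `H_q ∩ H_{q′}`** (every other class
represents `1`, `4` or `9`, FILE 1 `isSimpleDisc_iff_of_isDiscMatrix`).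
[cite: Runge1999EndomorphismRingsAbelianSurfaces, Remark 14 (p. 299, table: `h_QCM,simple = 0 0 0 0 0 1 0 0 0 1 0`) and §6 p. 296] -/
theorem not_isSimple_of_pairDiscr_le (h₀ : Z ∈ humbertLocus (fun i ↦ (q i : ℂ)))
    (h₁ : Z ∈ humbertLocus (fun i ↦ (q' i : ℂ))) (hli : LinearIndependent ℚ ![(fun i ↦ (q i : ℚ)), (fun i ↦ (q' i : ℚ))])
    (hd : pairDiscr q q' ≤ 11) (h5 : ¬ IsGLEquiv (discMatrix q q') !![5, 1; 1, 5])
    (h8 : ¬ IsGLEquiv (discMatrix q q') !![5, 0; 0, 8]) :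
    ¬ IsSimple (prinPeriod Z : (Fin 2 ⊕ Fin 2 → ℝ) ≃L[ℝ] (Fin 2 → ℂ)) := by
  refine not_isSimple_of_not_isSimpleDisc h₀ h₁ fun hs ↦ ?_
  have hpos := pairDiscr_pos h₀ h₁ hli
  have key := (isSimpleDisc_iff_of_isDiscMatrix (isDiscMatrix_discMatrix q q')
    (by simpa [discMatrix] using humbertInvariant_pos_left h₀ h₁ hli) (det_discMatrix_eq_four_mul h₀ h₁ hli)
    (by omega) (by omega)).1 hs
  exact key.elim h5 h8

/-- **Runge's `h_QCM,simple` row for `d ≤ 11`, on `𝔥₂`: for `Z ∈ H_q ∩ H_{q′}` (`q, q′` independent) with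
`d(ℤ[α, β]) ≤ 11`, `X_Z` is simple iff `ρ(X_Z) = 3` and `S_Δ(q, q′)` lies in the class of `(5 1; 1 5)` (`d = 6`) or of
`(5 0; 0 8)` (`d = 10`).** [cite: Runge1999EndomorphismRingsAbelianSurfaces, Remark 14 (p. 299, table) and §6 p. 296] -/
theorem isSimple_iff_of_pairDiscr_le (h₀ : Z ∈ humbertLocus (fun i ↦ (q i : ℂ)))
    (h₁ : Z ∈ humbertLocus (fun i ↦ (q' i : ℂ))) (hli : LinearIndependent ℚ ![(fun i ↦ (q i : ℚ)), (fun i ↦ (q' i : ℚ))])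
    (hd : pairDiscr q q' ≤ 11) :
    IsSimple (prinPeriod Z : (Fin 2 ⊕ Fin 2 → ℝ) ≃L[ℝ] (Fin 2 → ℂ)) ↔
      finrank ℤ (neronSeveriGroup (prinPeriod Z : (Fin 2 ⊕ Fin 2 → ℝ) ≃L[ℝ] (Fin 2 → ℂ))) = 3 ∧
        (IsGLEquiv (discMatrix q q') !![5, 1; 1, 5] ∨ IsGLEquiv (discMatrix q q') !![5, 0; 0, 8]) := by
  have hpos := pairDiscr_pos h₀ h₁ hli
  rw [isSimple_iff_of_mem_inter h₀ h₁ hli, ← isSimpleDisc_discMatrix_iff,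
    isSimpleDisc_iff_of_isDiscMatrix (isDiscMatrix_discMatrix q q')
      (by simpa [discMatrix] using humbertInvariant_pos_left h₀ h₁ hli) (det_discMatrix_eq_four_mul h₀ h₁ hli)
      (by omega) (by omega)]

end SimpleClasses

/-! ## §5 The Hashimoto–Murabayashi pair: `S_Δ = (8 −4; −4 5)`, `d = 6`, class `(5 1; 1 5)` — simple -/

section HashimotoMurabayashi

/-- **Hashimoto–Murabayashi's first singular relation `−τ₁ + 2τ₃ + 1 = 0` ("with `Δ = 8`")** of their
discriminant-`6` family (Lemma 4.1.1), as the B–W vector `q = (−1, 0, 2, 0, 1)` (rows A4-66/67 used this pair for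
validation). [cite: HashimotoMurabayashi1995, §4.1 Lemma 4.1.1 (RIMS Kôkyûroku 843 version of the held text, p. 193)] -/
def hmRel : Fin 5 → ℤ := ![-1, 0, 2, 0, 1]

/-- **Hashimoto–Murabayashi's second singular relation `τ₂ − τ₃ + (τ₂² − τ₁τ₃) − 1 = 0` ("with `Δ = 5`")**, as the
B–W vector `q′ = (0, 1, −1, 1, −1)`. [cite: HashimotoMurabayashi1995, §4.1 Lemma 4.1.1 (RIMS Kôkyûroku 843 version of the held text, p. 193)] -/
def hmRel' : Fin 5 → ℤ := ![0, 1, -1, 1, -1]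

/-- The invariants printed by Hashimoto–Murabayashi: `Δ(q) = 8`, `Δ(q′) = 5`. [cite: HashimotoMurabayashi1995, §4.1 Lemma 4.1.1 (p. 193: "with `Δ = 8`", "with `Δ = 5`")] -/
theorem humbertInvariant_hmRel : humbertInvariant hmRel = 8 ∧ humbertInvariant hmRel' = 5 := by
  constructor <;> simp [humbertInvariant, hmRel, hmRel']

/-- `S_Δ(q, q′) = (8 −4; −4 5)` for the HM pair (`det = 24 = 4·6`). [cite: Runge1999EndomorphismRingsAbelianSurfaces, §6 Thm. 7 (p. 295)] -/
theorem discMatrix_hmRel : discMatrix hmRel hmRel' = !![8, -4; -4, 5] := by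
  ext i j
  fin_cases i <;> fin_cases j <;> simp [discMatrix, humbertInvariant, humbertPolar, hmRel, hmRel']

/-- `d = 6` for the HM pair. [cite: Runge1999EndomorphismRingsAbelianSurfaces, §6 Thm. 7 (p. 295: "`d(R) = det(S_Δ)/4`")] -/
theorem pairDiscr_hmRel : pairDiscr hmRel hmRel' = 6 := by
  have h := four_mul_pairDiscr hmRel hmRel'
  rw [discMatrix_hmRel, Matrix.det_fin_two_of] at h
  omega

/-- **The HM pair lies in the SIMPLE class of `d = 6`: `S_Δ ~ (5 1; 1 5)`** via `g = (0 1; 1 1)` (`det g = −1`).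
[cite: Runge1999EndomorphismRingsAbelianSurfaces, Remark 14 (p. 299)] -/
theorem isGLEquiv_hmRel : IsGLEquiv (discMatrix hmRel hmRel') !![5, 1; 1, 5] := by
  rw [discMatrix_hmRel]
  exact ⟨!![0, 1; 1, 1], by simp [Matrix.det_fin_two_of], by rw [discBaseChange_fin_two]; norm_num⟩

/-- The HM pair is `ℚ`-independent. [cite: Runge1999EndomorphismRingsAbelianSurfaces, §6 Thm. 7 (p. 295)] -/
theorem linearIndependent_hmRel :
    LinearIndependent ℚ ![(fun i ↦ (hmRel i : ℚ)), (fun i ↦ (hmRel' i : ℚ))] := by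
  rw [LinearIndependent.pair_iff]
  intro s s' h
  have h0 := congrFun h 0
  have h1 := congrFun h 1
  simp [hmRel, hmRel'] at h0 h1
  exact ⟨by linarith, h1⟩

/-- **Every `ρ = 3` point of the Hashimoto–Murabayashi locus `H_{(−1,0,2,0,1)} ∩ H_{(0,1,−1,1,−1)}` is SIMPLE** (a QM
abelian surface whose endomorphism algebra is the quaternion algebra `ℚ(α, β) ≃ ℍ[ℚ, 8, −24]` of discriminant `6`,
row A4-66 FILE 3; HM §4.1: the family with `End ⊇ 𝒪₆`). [cite: Runge1999EndomorphismRingsAbelianSurfaces, Remark 14 (p. 299) and §1 p. 283] [cite: HashimotoMurabayashi1995, §4.1 Lemma 4.1.1 (p. 193)] -/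
theorem isSimple_of_mem_hmRel {Z : siegelUpperHalfSpace 2} (h₀ : Z ∈ humbertLocus (fun i ↦ (hmRel i : ℂ)))
    (h₁ : Z ∈ humbertLocus (fun i ↦ (hmRel' i : ℂ)))
    (h3 : finrank ℤ (neronSeveriGroup (prinPeriod Z : (Fin 2 ⊕ Fin 2 → ℝ) ≃L[ℝ] (Fin 2 → ℂ))) = 3) :
    IsSimple (prinPeriod Z : (Fin 2 ⊕ Fin 2 → ℝ) ≃L[ℝ] (Fin 2 → ℂ)) :=
  isSimple_of_isGLEquiv_five_one_five h₀ h₁ linearIndependent_hmRel h3 isGLEquiv_hmRel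

end HashimotoMurabayashi

/-! ## §6 Realisation: the standard pair of a positive definite admissible matrix has a common zero in `𝔥₂` -/

section Realisation

/-- A real symmetric `2 × 2` matrix with `p > 0` and `ps − r² > 0` is positive definite (`p·Q(v) = (pv₀ + rv₁)² + (ps − r²)v₁²`). [folklore] -/
private theorem posDef_fin_two {p r s : ℝ} (hp : 0 < p) (hdet : 0 < p * s - r ^ 2) :
    (!![p, r; r, s] : Matrix (Fin 2) (Fin 2) ℝ).PosDef := by
  rw [Matrix.posDef_iff_dotProduct_mulVec]
  refine ⟨Matrix.IsHermitian.ext fun i j ↦ by fin_cases i <;> fin_cases j <;> simp, fun v hv ↦ ?_⟩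
  have hQ : star v ⬝ᵥ !![p, r; r, s] *ᵥ v = p * v 0 ^ 2 + 2 * r * v 0 * v 1 + s * v 1 ^ 2 := by
    simp [Matrix.mulVec, dotProduct, Fin.sum_univ_two]; ring
  rw [hQ]
  have hv' : v 0 ≠ 0 ∨ v 1 ≠ 0 := by
    by_contra h
    push Not at h
    exact hv (funext fun i ↦ by fin_cases i <;> simp [h.1, h.2])
  have key : p * (p * v 0 ^ 2 + 2 * r * v 0 * v 1 + s * v 1 ^ 2) =
      (p * v 0 + r * v 1) ^ 2 + (p * s - r ^ 2) * v 1 ^ 2 := by ring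
  have hpos : 0 < p * (p * v 0 ^ 2 + 2 * r * v 0 * v 1 + s * v 1 ^ 2) := by
    rw [key]
    rcases hv' with h0 | h1
    · by_cases h1 : v 1 = 0
      · have hpv : p * v 0 ≠ 0 := mul_ne_zero hp.ne' h0
        rw [h1]; nlinarith [sq_pos_of_ne_zero hpv]
      · nlinarith [sq_nonneg (p * v 0 + r * v 1), mul_pos hdet (sq_pos_of_ne_zero h1)]
    · nlinarith [sq_nonneg (p * v 0 + r * v 1), mul_pos hdet (sq_pos_of_ne_zero h1)]
  exact (mul_pos_iff_of_pos_left hp).1 hpos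

/-- The symmetric complex matrix `(z₁ z₂; z₂ z₃)`. [folklore] -/
private def symZ (z₁ z₂ z₃ : ℂ) : Matrix (Fin 2) (Fin 2) ℂ := !![z₁, z₂; z₂, z₃]

/-- `(z₁ z₂; z₂ z₃)` is symmetric. [folklore] -/
private theorem symZ_isSymm (z₁ z₂ z₃ : ℂ) : (symZ z₁ z₂ z₃).IsSymm :=
  Matrix.IsSymm.ext fun i j ↦ by fin_cases i <;> fin_cases j <;> rfl

/-- Imaginary part of `(z₁ z₂; z₂ z₃)`. [folklore] -/
private theorem symZ_map_im (z₁ z₂ z₃ : ℂ) :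
    (symZ z₁ z₂ z₃).map Complex.im = !![z₁.im, z₂.im; z₂.im, z₃.im] := by
  ext i j; fin_cases i <;> fin_cases j <;> rfl

/-- `(z₁ z₂; z₂ z₃) ∈ 𝔥₂` from `Im z₁ > 0` and `Im z₁ · Im z₃ − (Im z₂)² > 0`. [folklore] -/
private theorem symZ_mem {z₁ z₂ z₃ : ℂ} (h1 : 0 < z₁.im) (hdet : 0 < z₁.im * z₃.im - z₂.im ^ 2) :
    symZ z₁ z₂ z₃ ∈ siegelUpperHalfSpace 2 := by
  rw [mem_siegelUpperHalfSpace_iff, symZ_map_im]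
  exact ⟨symZ_isSymm _ _ _, posDef_fin_two h1 hdet⟩

/-- The two relations of the standard pair at `(z₁ z₂; z₂ z₃)`: `k z₁ + l z₂ − z₃` and `a z₁ + t z₂ + (z₂² − z₁z₃) + c`. [folklore] -/
private theorem singularRelation_pair_symZ (k l t a c : ℤ) (z₁ z₂ z₃ : ℂ) :
    singularRelation (fun i ↦ (humbertNormalForm k l i : ℂ)) (symZ z₁ z₂ z₃) = k * z₁ + l * z₂ - z₃ ∧
      singularRelation (fun i ↦ (rungeStdVector t a c i : ℂ)) (symZ z₁ z₂ z₃) =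
        a * z₁ + t * z₂ + (z₂ ^ 2 - z₁ * z₃) + c := by
  constructor
  · simp [singularRelation, humbertNormalForm, symZ]; ring
  · simp [singularRelation, rungeStdVector, symZ]

/-- **Realisation, case `k ≥ 1`**: for `k > 0` and `D := a² + alt + c(4k + l²) − kt² < 0` (i.e. `det S_Δ = −4D > 0`)
the standard pair has a common zero in `𝔥₂` — `z₂ = s = (al − 2kt)/(4k + l²)` real, `z₁` the root with positive
imaginary part of `kX² + (ls − a)X − (s² + ts + c)` (whose discriminant is `4kD/(4k + l²) < 0`), `z₃ = kz₁ + lz₂`,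
`Im Z = diag(y, ky)`. [cite: Runge1999EndomorphismRingsAbelianSurfaces, §6 proof of Thm. 10 (p. 298) and Remark 14 (p. 299)] -/
theorem exists_mem_inter_std_of_pos (k l t a c : ℤ) (hk : 0 < k)
    (hD : a ^ 2 + a * l * t + c * (4 * k + l ^ 2) - k * t ^ 2 < 0) :
    ∃ Z : siegelUpperHalfSpace 2, Z ∈ humbertLocus (fun i ↦ (humbertNormalForm k l i : ℂ)) ∧
      Z ∈ humbertLocus (fun i ↦ (rungeStdVector t a c i : ℂ)) := by
  have hK0 : (0 : ℝ) < k := by exact_mod_cast hk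
  have hΔ₁ : (0 : ℝ) < 4 * k + (l : ℝ) ^ 2 := by positivity
  have hDr : (a : ℝ) ^ 2 + a * l * t + c * (4 * k + (l : ℝ) ^ 2) - k * (t : ℝ) ^ 2 < 0 := by exact_mod_cast hD
  set s : ℝ := ((a : ℝ) * l - 2 * k * t) / (4 * k + (l : ℝ) ^ 2) with hs
  set E : ℝ := ((l : ℝ) * s - a) ^ 2 + 4 * k * (s ^ 2 + t * s + c) with hE
  have hEval : E * (4 * k + (l : ℝ) ^ 2) =
      4 * k * ((a : ℝ) ^ 2 + a * l * t + c * (4 * k + (l : ℝ) ^ 2) - k * (t : ℝ) ^ 2) := by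
    rw [hE, hs]; field_simp; ring
  have hEneg : E < 0 := by
    by_contra h
    push Not at h
    have : 0 ≤ E * (4 * k + (l : ℝ) ^ 2) := mul_nonneg h hΔ₁.le
    rw [hEval] at this
    nlinarith
  set r : ℝ := Real.sqrt (-E) with hr
  have hr0 : 0 < r := Real.sqrt_pos.2 (by linarith)
  have hrr : r * r = -E := Real.mul_self_sqrt (by linarith)
  set z₁ : ℂ := (((a : ℝ) - l * s : ℝ) + r * Complex.I) / ((2 * k : ℝ) : ℂ) with hz₁
  set z₂ : ℂ := (s : ℂ) with hz₂
  set z₃ : ℂ := (k : ℂ) * z₁ + (l : ℂ) * z₂ with hz₃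
  have hz₁im : z₁.im = r / (2 * k) := by
    rw [hz₁, Complex.div_ofReal_im]; simp
  have hy0 : 0 < z₁.im := by rw [hz₁im]; positivity
  have hz₃im : z₃.im = k * z₁.im := by
    rw [hz₃, hz₂]; simp
  have hmem : symZ z₁ z₂ z₃ ∈ siegelUpperHalfSpace 2 := by
    refine symZ_mem hy0 ?_
    rw [hz₃im, hz₂, Complex.ofReal_im]
    nlinarith [mul_pos hK0 (mul_pos hy0 hy0)]
  have hdisc : discrim (k : ℂ) ((l : ℂ) * s - a) (-((s : ℂ) ^ 2 + t * s + c)) = (r * Complex.I) * (r * Complex.I) := by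
    have hrrC : ((r * r : ℝ) : ℂ) = ((-E : ℝ) : ℂ) := by rw [hrr]
    rw [hE] at hrrC
    push_cast at hrrC
    rw [discrim]
    linear_combination hrrC - (r : ℂ) ^ 2 * Complex.I_mul_I
  have hquad : (k : ℂ) * (z₁ * z₁) + ((l : ℂ) * s - a) * z₁ + (-((s : ℂ) ^ 2 + t * s + c)) = 0 := by
    have hK' : (k : ℂ) ≠ 0 := by exact_mod_cast hk.ne'
    refine (quadratic_eq_zero_iff hK' hdisc z₁).2 (Or.inl ?_)
    rw [hz₁]; push_cast; ring
  refine ⟨⟨symZ z₁ z₂ z₃, hmem⟩, ?_, ?_⟩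
  · rw [mem_humbertLocus_iff]
    change singularRelation _ (symZ z₁ z₂ z₃) = 0
    rw [(singularRelation_pair_symZ k l t a c z₁ z₂ z₃).1, hz₃]; ring
  · rw [mem_humbertLocus_iff]
    change singularRelation _ (symZ z₁ z₂ z₃) = 0
    rw [(singularRelation_pair_symZ k l t a c z₁ z₂ z₃).2]
    have hrel : (a : ℂ) * z₁ + t * z₂ + (z₂ ^ 2 - z₁ * z₃) + c =
        -((k : ℂ) * (z₁ * z₁) + ((l : ℂ) * s - a) * z₁ + (-((s : ℂ) ^ 2 + t * s + c))) := by
      rw [hz₃, hz₂]; ring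
    rw [hrel, hquad, neg_zero]

/-- **Realisation, case `k = 0`, `l = 1`** (`Δ(α) = 1`): `D = a² + at + c < 0`; the point `z₂ = z₃ = a + i`,
`z₁ = (2a + t) + (1 − D)i` (so `z₁(z₂ − a) = z₂² + tz₂ + c`), `Im Z = (1 − D, 1; 1, 1)`. [cite: Runge1999EndomorphismRingsAbelianSurfaces, §6 proof of Thm. 10 (p. 298) and Remark 14 (p. 299)] -/
theorem exists_mem_inter_std_of_zero (t a c : ℤ) (hD : a ^ 2 + a * t + c < 0) :
    ∃ Z : siegelUpperHalfSpace 2, Z ∈ humbertLocus (fun i ↦ (humbertNormalForm 0 1 i : ℂ)) ∧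
      Z ∈ humbertLocus (fun i ↦ (rungeStdVector t a c i : ℂ)) := by
  have hDr : (a : ℝ) ^ 2 + a * t + c < 0 := by exact_mod_cast hD
  set z₂ : ℂ := ⟨a, 1⟩ with hz₂
  set z₁ : ℂ := ⟨2 * a + t, 1 - ((a : ℝ) ^ 2 + a * t + c)⟩ with hz₁
  have hmem : symZ z₁ z₂ z₂ ∈ siegelUpperHalfSpace 2 := by
    refine symZ_mem (by rw [hz₁]; simp only; linarith) ?_
    rw [hz₁, hz₂]; simp only; nlinarith
  refine ⟨⟨symZ z₁ z₂ z₂, hmem⟩, ?_, ?_⟩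
  · rw [mem_humbertLocus_iff]
    change singularRelation _ (symZ z₁ z₂ z₂) = 0
    rw [(singularRelation_pair_symZ 0 1 t a c z₁ z₂ z₂).1]; push_cast; ring
  · rw [mem_humbertLocus_iff]
    change singularRelation _ (symZ z₁ z₂ z₂) = 0
    rw [(singularRelation_pair_symZ 0 1 t a c z₁ z₂ z₂).2]
    apply Complex.ext
    · rw [hz₁, hz₂]
      simp only [Complex.add_re, Complex.mul_re, Complex.sub_re, Complex.intCast_re, Complex.intCast_im, sq,
        Complex.zero_re]
      ring
    · rw [hz₁, hz₂]
      simp only [Complex.add_im, Complex.mul_im, Complex.sub_im, Complex.intCast_re, Complex.intCast_im, sq,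
        Complex.zero_im]
      ring

/-- `det S_Δ = −4D` for the standard pair, `D = a² + alt + c(4k + l²) − kt²`. [cite: Runge1999EndomorphismRingsAbelianSurfaces, §6 proof of Thm. 10 (p. 298) and Remark 14 (p. 299)] -/
theorem det_discMatrix_std_eq (k l t a c : ℤ) :
    (4 * k + l ^ 2) * (t ^ 2 - 4 * c) - (l * t + 2 * a) ^ 2 =
      -4 * (a ^ 2 + a * l * t + c * (4 * k + l ^ 2) - k * t ^ 2) := by
  ring

/-- **REALISATION OF THE STANDARD PAIR: for `l ∈ {0, 1}`, `Δ(α) = 4k + l² > 0` and `det S_Δ > 0` the loci meet: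
`H_{(k,l,−1,0,0)} ∩ H_{(a,t,0,1,c)} ≠ ∅`.** [cite: Runge1999EndomorphismRingsAbelianSurfaces, §6 proof of Thm. 10 (p. 298) and Remark 14 (p. 299)] -/
theorem exists_mem_inter_std {k l t a c : ℤ} (hl : l = 0 ∨ l = 1) (hΔ : 0 < 4 * k + l ^ 2)
    (hdet : 0 < (4 * k + l ^ 2) * (t ^ 2 - 4 * c) - (l * t + 2 * a) ^ 2) :
    ∃ Z : siegelUpperHalfSpace 2, Z ∈ humbertLocus (fun i ↦ (humbertNormalForm k l i : ℂ)) ∧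
      Z ∈ humbertLocus (fun i ↦ (rungeStdVector t a c i : ℂ)) := by
  rw [det_discMatrix_std_eq] at hdet
  have hD : a ^ 2 + a * l * t + c * (4 * k + l ^ 2) - k * t ^ 2 < 0 := by linarith
  rcases lt_or_ge 0 k with hk | hk
  · exact exists_mem_inter_std_of_pos k l t a c hk hD
  · obtain ⟨rfl, rfl⟩ : k = 0 ∧ l = 1 := by rcases hl with rfl | rfl <;> constructor <;> omega
    exact exists_mem_inter_std_of_zero t a c (by simpa using hD)

/-- **EVERY POSITIVE DEFINITE ADMISSIBLE MATRIX IS REALISED ON `𝔥₂`**: if `S` satisfies Remark 14's congruences with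
`Δ₁ > 0` and `det S > 0`, there are primitive, independent singular relations `q, q′` with `S_Δ(q, q′) = S` EXACTLY
and a point `Z ∈ H_q ∩ H_{q′}` — so every class counted by `h_QCM(d)` occurs (the converse of row A4-66 FILE 3's
`det_discMatrix_pos`, which shows `S_Δ` is positive definite at any point of `H_q ∩ H_{q′}`).
[cite: Runge1999EndomorphismRingsAbelianSurfaces, §6 proof of Thm. 10 (p. 298) and Remark 14 (p. 299)] -/
theorem exists_pair_and_mem_of_isDiscMatrix {S : Matrix (Fin 2) (Fin 2) ℤ} (hS : IsDiscMatrix S) (ha : 0 < S 0 0)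
    (hdet : 0 < S.det) :
    ∃ q q' : Fin 5 → ℤ, IsPrimitiveRel q ∧ IsPrimitiveRel q' ∧
      LinearIndependent ℚ ![(fun i ↦ (q i : ℚ)), (fun i ↦ (q' i : ℚ))] ∧ discMatrix q q' = S ∧
      ∃ Z : siegelUpperHalfSpace 2, Z ∈ humbertLocus (fun i ↦ (q i : ℂ)) ∧ Z ∈ humbertLocus (fun i ↦ (q' i : ℂ)) := by
  obtain ⟨k, l, t, a, c, hl, -, h⟩ := exists_pair_discMatrix_eq hS
  have hM := discMatrix_humbertNormalForm_rungeStdVector t a c k l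
  have h00 : S 0 0 = 4 * k + l ^ 2 := by rw [← h, hM]; simp
  have hd : S.det = (4 * k + l ^ 2) * (t ^ 2 - 4 * c) - (l * t + 2 * a) ^ 2 := by
    rw [← h, hM, Matrix.det_fin_two_of]; ring
  refine ⟨_, _, isPrimitiveRel_humbertNormalForm k l, isPrimitiveRel_rungeStdVector t a c,
    linearIndependent_humbertNormalForm_rungeStdVector t a c k l, h, ?_⟩
  exact exists_mem_inter_std hl (by rw [← h00]; exact ha) (by rw [← hd]; exact hdet)

/-- **… hence every such `S` is the discriminant matrix of an order `ℤ[α, β] ⊆ ρ_r(End(X_Z))` of some principally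
polarised abelian surface `X_Z`, with `d(ℤ[α, β]) = det(S)/4`** (rows A4-67 FILE 2 `humbertPairOrder_le_endRingInt_iff`,
`four_mul_pairDiscr`): the "discriminant forms of QCM-orders" of Remark 14 all occur. (That `ℤ[α, β]` is the FULL
endomorphism ring at a general point — a QCM-order in Runge's sense — is not claimed.) [cite: Runge1999EndomorphismRingsAbelianSurfaces, §6 proof of Thm. 10 (p. 298) and Remark 14 (p. 299)] -/
theorem exists_order_of_isDiscMatrix {S : Matrix (Fin 2) (Fin 2) ℤ} (hS : IsDiscMatrix S) (ha : 0 < S 0 0)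
    (hdet : 0 < S.det) :
    ∃ (q q' : Fin 5 → ℤ) (Z : siegelUpperHalfSpace 2), discMatrix q q' = S ∧ 4 * pairDiscr q q' = S.det ∧
      ∀ x ∈ humbertPairOrder q q', x ∈ endRingInt (prinPeriod Z : (Fin 2 ⊕ Fin 2 → ℝ) ≃L[ℝ] (Fin 2 → ℂ)) := by
  obtain ⟨q, q', -, -, -, h, Z, h₀, h₁⟩ := exists_pair_and_mem_of_isDiscMatrix hS ha hdet
  exact ⟨q, q', Z, h, by rw [four_mul_pairDiscr, h], (humbertPairOrder_le_endRingInt_iff q q' Z).2 ⟨h₀, h₁⟩⟩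

end Realisation

end SiegelModuli

end Literature.AlgebraicGeometry.ModuliOfAbelianVarieties
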